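import Summits.BirchSwinnertonDyer.BirchSwinnertonDyer.Theorems.ErratumRoadFiveEulerHalfNotRamRung8085y1SplitSetRoad
import Summits.BirchSwinnertonDyer.Rank1Residual.X11b.BDPRouteTamagawaSupport
import Summits.BirchSwinnertonDyer.Rank1Residual.X9.PrintCertBridge
import HarnessLib

/-!
# Route `ErratumRoadFive`, crux `EulerHalfNotRamNoInertSetAtFive` (item stmt-BirchSwinnertonDyer-19715), line `birth` (v10–v13): the LOCAL
# BINDERS of the registered BC5 rung **(8085y1, 5)** HOLD in the kernel — `3` and `11` SPLIT offending carriers, `7` additive, hence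
# `¬ Ram E 5`, `5 ∣ ∏ c_ℓ(E)`, «a multiplicative ℓ ≠ 5», and NO inert set ∋ 5 (the crux's «no inert-set datum» in every currency)

Cell `bsd-stepL`, seat `bsd-line-er5-p1-w4` (D-0154 width seat -w4 on crux 19715, lead `bsd-line-er5-p1`), `--supports stmt-BirchSwinnertonDyer-19715
--as helper`. THEOREMS ONLY. ONE curve: `E = [0,1,1,−6435,−644416]` = Cremona 8085y1 (`N = 3·5·7²·11`, `Δ_min = −3⁵·5·7⁷·11⁵`, `c₄ = 2⁵·7²·197`).
The registered rung `Statement.stub_rung_res_8085y1` of `Cruxes/…/Lines/birth.lean` is DERIVED modulo the route items (v12, `Birth.rung_res_8085y1_of_items`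
:= -w2 g0's p613003 on the split-set datum `S = {3, 11}`, `R = {3}`; tam3-p2 g4's `…Rung8085y1Kernel` reaches it from published inputs + a REGMULT
row); its OWN binders `¬ Ram E 5`, `5 ∣ ∏c`, «∃ multiplicative ℓ ≠ 5», «no inert-set datum» are hypotheses there. HERE they are PROVED: over
p613003's integer-model facts (`Rung8085y1.mult_three ∕ mult_eleven ∕ minimalDiscriminantInt_eq ∕ eq_of_prime_dvd_Δ`, imported — hence this file
sits in the route cone with p613003) and tam3-p2's `RegMult.Rung8085y1.{integralModelInt_eq, mult_five, split_five}`, this file adds `split_three`,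
`split_eleven` (nodal roots `1`, `1`), `not_mult_seven` (additive: `7 ∣ Δ`, `7 ∣ c₄`), `ord₃ = ord₁₁ = 5`, `eq_of_mult` (multiplicative ⟹ `∈ {3, 5, 11}`),
`not_ram_five`, `five_dvd_tamagawaProduct` (`c₃ = 5`), `exists_otherMult`, `no_inertSet` (an even `S ∋ 5` off which no split prime offends contains
`3` and `11` and lies in `{3, 5, 11}` — three elements) and `binders_hold`. With -w3 g0's `Rung129360cy1.binders_hold` (p627895) and this seat's
`…RungsSplitSetTwoBinders` ∕ `…Rung605a1LocalData`, EVERY rung pair of the line (8085y1, 605a1, 129360cy1, and the five `q = 2` pairs) has its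
local binders certified in the kernel; the non-local ones (`r_an = 1`, `Irr`, `Surj`) are Cremona table data (8085y1: rank 1, `galrep` no
exceptional prime).

HONEST FRAMING: local facts of one explicit curve + bookkeeping; no definition, no named fact, no `sorry`; a helper, not a closure of crux 19715;
BSD(8085y1, 5) is NOT proved by this; nothing booked; no summit statement is touched. References: [Cremona1997] Table 1 (curve 8085y1);
[SilvermanAEC2009] VII.5 Prop. 5.1(b),(c); [SilvermanATAEC1994] Cor. IV.9.2(d); [SkinnerUrban2014] Thm. 2; [PastenShimura2024] §6.6.
-/

noncomputable section

open scoped Classical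

open WeierstrassCurve Literature.NumberTheory.EllipticCurves Literature.NumberTheory.EllipticCurves.Rank1Residual
  Summit.BirchSwinnertonDyer.Rank1Residual Summit.BirchSwinnertonDyer.Rank1Residual.X11b
  Summit.BirchSwinnertonDyer.BirchSwinnertonDyer.Rank1Residual

set_option linter.dupNamespace false -- the cell's Theorems namespace repeats the summit name, as in every sibling file

namespace Summit.BirchSwinnertonDyer.BirchSwinnertonDyer.Theorems.EulerHalfSplitTwinRoad.Rung8085y1

/-! ### More integer-model facts of 8085y1 (over p613003 ∕ `RegMult.Rung8085y1`) -/

/-- The node-tangent quadratic `c₄t² + a₁c₄t − (54b₆ − 3b₂b₄ + a₂c₄)` of the integer equation has the root `t = 1` modulo `3`.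
[cite: SilvermanAEC2009, VII.5 Prop. 5.1(b)] -/
theorem nodal_root_three :
    ∃ t : ZMod 3, ((⟨0, 1, 1, -6435, -644416⟩ : WeierstrassCurve ℤ).c₄ : ZMod 3) * t ^ 2 +
      ((⟨0, 1, 1, -6435, -644416⟩ : WeierstrassCurve ℤ).a₁ * (⟨0, 1, 1, -6435, -644416⟩ : WeierstrassCurve ℤ).c₄ : ZMod 3) * t -
        (54 * (⟨0, 1, 1, -6435, -644416⟩ : WeierstrassCurve ℤ).b₆ - 3 * (⟨0, 1, 1, -6435, -644416⟩ : WeierstrassCurve ℤ).b₂ *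
          (⟨0, 1, 1, -6435, -644416⟩ : WeierstrassCurve ℤ).b₄ + (⟨0, 1, 1, -6435, -644416⟩ : WeierstrassCurve ℤ).a₂ *
          (⟨0, 1, 1, -6435, -644416⟩ : WeierstrassCurve ℤ).c₄ : ZMod 3) = 0 :=
  ⟨1, by simp only [WeierstrassCurve.c₄, WeierstrassCurve.b₂, WeierstrassCurve.b₄, WeierstrassCurve.b₆]; decide⟩

/-- The node-tangent quadratic of the integer equation has the root `t = 1` modulo `11`. [cite: SilvermanAEC2009, VII.5 Prop. 5.1(b)] -/
theorem nodal_root_eleven :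
    ∃ t : ZMod 11, ((⟨0, 1, 1, -6435, -644416⟩ : WeierstrassCurve ℤ).c₄ : ZMod 11) * t ^ 2 +
      ((⟨0, 1, 1, -6435, -644416⟩ : WeierstrassCurve ℤ).a₁ * (⟨0, 1, 1, -6435, -644416⟩ : WeierstrassCurve ℤ).c₄ : ZMod 11) * t -
        (54 * (⟨0, 1, 1, -6435, -644416⟩ : WeierstrassCurve ℤ).b₆ - 3 * (⟨0, 1, 1, -6435, -644416⟩ : WeierstrassCurve ℤ).b₂ *
          (⟨0, 1, 1, -6435, -644416⟩ : WeierstrassCurve ℤ).b₄ + (⟨0, 1, 1, -6435, -644416⟩ : WeierstrassCurve ℤ).a₂ *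
          (⟨0, 1, 1, -6435, -644416⟩ : WeierstrassCurve ℤ).c₄ : ZMod 11) = 0 :=
  ⟨1, by simp only [WeierstrassCurve.c₄, WeierstrassCurve.b₂, WeierstrassCurve.b₄, WeierstrassCurve.b₆]; decide⟩

/-- **`E` is SPLIT multiplicative at `3`** (nodal root modulo `3`). [cite: SilvermanAEC2009, VII.5 Prop. 5.1(b)] [cite: Cremona1997, Table 1 (curve 8085y1)] -/
theorem split_three [Fact (Nat.Prime 3)] [((⟨0, 1, 1, -6435, -644416⟩ : WeierstrassCurve ℤ).baseChange ℚ).IsElliptic]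
    [((⟨0, 1, 1, -6435, -644416⟩ : WeierstrassCurve ℤ).baseChange ℚ).IsGloballyMinimal] :
    ((⟨0, 1, 1, -6435, -644416⟩ : WeierstrassCurve ℤ).baseChange ℚ).HasSplitMultiplicativeReductionAtPrime 3 :=
  IntModel.hasSplitMultiplicativeReductionAtPrime_of_intModel_of_root RegMult.Rung8085y1.integralModelInt_eq 3
    (by rw [Δ_eq]; norm_num) (by rw [c₄_eq]; norm_num) nodal_root_three

/-- **`E` is SPLIT multiplicative at `11`** (nodal root modulo `11`). [cite: SilvermanAEC2009, VII.5 Prop. 5.1(b)] [cite: Cremona1997, Table 1 (curve 8085y1)] -/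
theorem split_eleven [Fact (Nat.Prime 11)] [((⟨0, 1, 1, -6435, -644416⟩ : WeierstrassCurve ℤ).baseChange ℚ).IsElliptic]
    [((⟨0, 1, 1, -6435, -644416⟩ : WeierstrassCurve ℤ).baseChange ℚ).IsGloballyMinimal] :
    ((⟨0, 1, 1, -6435, -644416⟩ : WeierstrassCurve ℤ).baseChange ℚ).HasSplitMultiplicativeReductionAtPrime 11 :=
  IntModel.hasSplitMultiplicativeReductionAtPrime_of_intModel_of_root RegMult.Rung8085y1.integralModelInt_eq 11
    (by rw [Δ_eq]; norm_num) (by rw [c₄_eq]; norm_num) nodal_root_eleven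

/-- **`E` is NOT multiplicative at `7`** (`7 ∣ Δ`, `7 ∣ c₄`: additive, `7² ∥ N`). [cite: SilvermanAEC2009, VII.5 Prop. 5.1(c)]
[cite: Cremona1997, Table 1 (curve 8085y1)] -/
theorem not_mult_seven [Fact (Nat.Prime 7)] [((⟨0, 1, 1, -6435, -644416⟩ : WeierstrassCurve ℤ).baseChange ℚ).IsElliptic]
    [((⟨0, 1, 1, -6435, -644416⟩ : WeierstrassCurve ℤ).baseChange ℚ).IsGloballyMinimal] :
    ¬ ((⟨0, 1, 1, -6435, -644416⟩ : WeierstrassCurve ℤ).baseChange ℚ).HasMultiplicativeReductionAtPrime 7 :=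
  Summit.BirchSwinnertonDyer.Rank1Residual.X9.PrintCert.not_hasMultiplicativeReductionAtPrime_of_dvd_of_dvd RegMult.Rung8085y1.integralModelInt_eq 7
    (by rw [Δ_eq]; norm_num) (by rw [c₄_eq]; norm_num)

/-- `ord₃Δ_min(E) = 5`. [cite: Cremona1997, Table 1 (curve 8085y1)] -/
theorem padicValInt_three_eq [Fact (Nat.Prime 3)] [((⟨0, 1, 1, -6435, -644416⟩ : WeierstrassCurve ℤ).baseChange ℚ).IsGloballyMinimal] :
    padicValInt 3 ((⟨0, 1, 1, -6435, -644416⟩ : WeierstrassCurve ℤ).baseChange ℚ).minimalDiscriminantInt = 5 := by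
  rw [minimalDiscriminantInt_eq]
  exact IntModel.padicValInt_eq_of_dvd_of_not_dvd 3 (e := 5) (by norm_num) (by norm_num)

/-- `ord₁₁Δ_min(E) = 5`. [cite: Cremona1997, Table 1 (curve 8085y1)] -/
theorem padicValInt_eleven_eq [Fact (Nat.Prime 11)] [((⟨0, 1, 1, -6435, -644416⟩ : WeierstrassCurve ℤ).baseChange ℚ).IsGloballyMinimal] :
    padicValInt 11 ((⟨0, 1, 1, -6435, -644416⟩ : WeierstrassCurve ℤ).baseChange ℚ).minimalDiscriminantInt = 5 := by
  rw [minimalDiscriminantInt_eq]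
  exact IntModel.padicValInt_eq_of_dvd_of_not_dvd 11 (e := 5) (by norm_num) (by norm_num)

/-- **The multiplicative primes of `E` are among `3, 5, 11`**: a multiplicative prime divides `Δ_min = −3⁵·5·7⁷·11⁵`, and `7` is additive.
[cite: Cremona1997, Table 1 (curve 8085y1)] [cite: SilvermanAEC2009, VII.5 Prop. 5.1(b),(c)] -/
theorem eq_of_mult [((⟨0, 1, 1, -6435, -644416⟩ : WeierstrassCurve ℤ).baseChange ℚ).IsElliptic]
    [((⟨0, 1, 1, -6435, -644416⟩ : WeierstrassCurve ℤ).baseChange ℚ).IsGloballyMinimal] :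
    ∀ (ℓ : ℕ) [Fact ℓ.Prime], ((⟨0, 1, 1, -6435, -644416⟩ : WeierstrassCurve ℤ).baseChange ℚ).HasMultiplicativeReductionAtPrime ℓ →
      ℓ = 3 ∨ ℓ = 5 ∨ ℓ = 11 := by
  intro ℓ hℓF hm
  have hdvd : (ℓ : ℤ) ∣ ((⟨0, 1, 1, -6435, -644416⟩ : WeierstrassCurve ℤ).baseChange ℚ).minimalDiscriminantInt := by
    by_contra h
    exact WeierstrassCurve.HasMultiplicativeReduction.not_hasGoodReduction (R := ℤ_[ℓ]) hm
      (WeierstrassCurve.hasGoodReductionAtPrime_of_not_dvd _ ℓ h)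
  rw [minimalDiscriminantInt_eq] at hdvd
  rcases eq_of_prime_dvd_Δ hℓF.out hdvd with h | h | rfl | h
  · exact Or.inl h
  · exact Or.inr (Or.inl h)
  · exact absurd hm not_mult_seven
  · exact Or.inr (Or.inr h)

/-! ### The binders of the rung at (8085y1, 5) -/

/-- **¬(ram) at (8085y1, 5)**: the multiplicative primes `≠ 5` are the carriers `3` and `11` (`ord = 5`). [cite: SkinnerUrban2014, Thm. 2 (p. 3)]
[cite: Cremona1997, Table 1 (curve 8085y1)] -/
theorem not_ram_five [Fact (Nat.Prime 5)] [((⟨0, 1, 1, -6435, -644416⟩ : WeierstrassCurve ℤ).baseChange ℚ).IsElliptic]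
    [((⟨0, 1, 1, -6435, -644416⟩ : WeierstrassCurve ℤ).baseChange ℚ).IsGloballyMinimal] :
    ¬ Ram ((⟨0, 1, 1, -6435, -644416⟩ : WeierstrassCurve ℤ).baseChange ℚ) 5 := by
  rintro ⟨ℓ, hℓF, hℓ5, hm, hnd⟩
  rcases eq_of_mult ℓ hm with rfl | rfl | rfl
  · exact hnd (by rw [padicValInt_three_eq])
  · exact hℓ5 rfl
  · exact hnd (by rw [padicValInt_eleven_eq])

/-- **`5 ∣ ∏ c_ℓ(E)`**: the split carrier `3` has `5 ∣ ord₃Δ_min = 5 = c₃` (tree `X11b.dvd_tamagawaProduct_iff_exists_split`; in fact `c₃ = c₁₁ = 5`).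
[cite: SilvermanATAEC1994, Cor. IV.9.2(d) (PDF p. 340)] [cite: Cremona1997, Table 1 (curve 8085y1)] -/
theorem five_dvd_tamagawaProduct [Fact (Nat.Prime 5)] [((⟨0, 1, 1, -6435, -644416⟩ : WeierstrassCurve ℤ).baseChange ℚ).IsElliptic]
    [((⟨0, 1, 1, -6435, -644416⟩ : WeierstrassCurve ℤ).baseChange ℚ).IsGloballyMinimal] :
    5 ∣ ((⟨0, 1, 1, -6435, -644416⟩ : WeierstrassCurve ℤ).baseChange ℚ).tamagawaProduct :=
  haveI : Fact (Nat.Prime 3) := ⟨Nat.prime_three⟩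
  (X11b.dvd_tamagawaProduct_iff_exists_split ((⟨0, 1, 1, -6435, -644416⟩ : WeierstrassCurve ℤ).baseChange ℚ) Nat.prime_five le_rfl).mpr
    ⟨3, inferInstance, split_three, by rw [padicValInt_three_eq]⟩

/-- **A second multiplicative prime**: `3 ≠ 5` (the pair is in piece S2 of line `birth`). [cite: Cremona1997, Table 1 (curve 8085y1)] -/
theorem exists_otherMult [((⟨0, 1, 1, -6435, -644416⟩ : WeierstrassCurve ℤ).baseChange ℚ).IsElliptic]
    [((⟨0, 1, 1, -6435, -644416⟩ : WeierstrassCurve ℤ).baseChange ℚ).IsGloballyMinimal] :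
    ∃ ℓ : ℕ, ∃ _ : Fact ℓ.Prime, ℓ ≠ 5 ∧ ((⟨0, 1, 1, -6435, -644416⟩ : WeierstrassCurve ℤ).baseChange ℚ).HasMultiplicativeReductionAtPrime ℓ :=
  ⟨3, ⟨Nat.prime_three⟩, by decide, mult_three⟩

/-- **NO INERT SET at (8085y1, 5)** — the strongest form (no degree ∕ pairing clause): an even `S ∋ 5` of multiplicative primes off which no split
prime offends contains the split carriers `3` and `11` and lies in `{3, 5, 11}`, so `S = {3, 5, 11}` — three elements. So the pair is a GENUINE
member of crux 19715 (no inert re-key datum in any currency), served by the split-set road (`S = {3, 11}`, `R = {3}`, p613003).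
[cite: Cremona1997, Table 1 (curve 8085y1)] [cite: PastenShimura2024, §6.6] -/
theorem no_inertSet [Fact (Nat.Prime 5)] [((⟨0, 1, 1, -6435, -644416⟩ : WeierstrassCurve ℤ).baseChange ℚ).IsElliptic]
    [((⟨0, 1, 1, -6435, -644416⟩ : WeierstrassCurve ℤ).baseChange ℚ).IsGloballyMinimal] :
    ¬ ∃ S : Finset ℕ, (∀ ℓ ∈ S, ∃ _ : Fact ℓ.Prime, Mult ((⟨0, 1, 1, -6435, -644416⟩ : WeierstrassCurve ℤ).baseChange ℚ) ℓ) ∧ Even S.card ∧ 5 ∈ S ∧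
      (∀ (ℓ : ℕ) [Fact ℓ.Prime], ℓ ∉ S → ((⟨0, 1, 1, -6435, -644416⟩ : WeierstrassCurve ℤ).baseChange ℚ).HasSplitMultiplicativeReductionAtPrime ℓ →
        ¬ 5 ∣ padicValInt ℓ ((⟨0, 1, 1, -6435, -644416⟩ : WeierstrassCurve ℤ).baseChange ℚ).minimalDiscriminantInt) := by
  rintro ⟨S, hSm, hSe, h5, hFC⟩
  haveI h3F : Fact (Nat.Prime 3) := ⟨Nat.prime_three⟩
  haveI h11F : Fact (Nat.Prime 11) := ⟨by norm_num⟩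
  have h3 : 3 ∈ S := by
    by_contra h
    exact hFC 3 h split_three (by rw [padicValInt_three_eq])
  have h11 : 11 ∈ S := by
    by_contra h
    exact hFC 11 h split_eleven (by rw [padicValInt_eleven_eq])
  have hS : S = {3, 5, 11} := by
    refine Finset.Subset.antisymm ?_ ?_
    · intro ℓ hℓ
      obtain ⟨hF, hm⟩ := hSm ℓ hℓ
      rcases eq_of_mult ℓ hm with rfl | rfl | rfl <;> simp
    · intro ℓ hℓ
      simp only [Finset.mem_insert, Finset.mem_singleton] at hℓ
      rcases hℓ with rfl | rfl | rfl
      · exact h3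
      · exact h5
      · exact h11
  rw [hS] at hSe
  exact absurd hSe (by decide)

/-- **The LOCAL binders of the registered rung `stub_rung_res_8085y1` HOLD at (8085y1, 5)**: `Mult E 5 ∧ ¬ Ram E 5 ∧ 5 ∣ ∏c ∧ (∃ multiplicative
ℓ ≠ 5) ∧ «no inert-set datum»` (crux currency; a corollary of `no_inertSet`). The remaining binders `r_an = 1`, `Irr`, `Surj` are the pair's
Cremona `allbsd`∕`galrep` data, not kernel statements. [cite: Cremona1997, Table 1 (curve 8085y1)] -/
theorem binders_hold [Fact (Nat.Prime 5)] [((⟨0, 1, 1, -6435, -644416⟩ : WeierstrassCurve ℤ).baseChange ℚ).IsElliptic]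
    [((⟨0, 1, 1, -6435, -644416⟩ : WeierstrassCurve ℤ).baseChange ℚ).IsGloballyMinimal] :
    Mult ((⟨0, 1, 1, -6435, -644416⟩ : WeierstrassCurve ℤ).baseChange ℚ) 5 ∧
      ¬ Ram ((⟨0, 1, 1, -6435, -644416⟩ : WeierstrassCurve ℤ).baseChange ℚ) 5 ∧
      5 ∣ ((⟨0, 1, 1, -6435, -644416⟩ : WeierstrassCurve ℤ).baseChange ℚ).tamagawaProduct ∧
      (∃ ℓ : ℕ, ∃ _ : Fact ℓ.Prime, ℓ ≠ 5 ∧ ((⟨0, 1, 1, -6435, -644416⟩ : WeierstrassCurve ℤ).baseChange ℚ).HasMultiplicativeReductionAtPrime ℓ) ∧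
      ¬ (∃ S : Finset ℕ, (∀ ℓ ∈ S, ∃ _ : Fact ℓ.Prime, Mult ((⟨0, 1, 1, -6435, -644416⟩ : WeierstrassCurve ℤ).baseChange ℚ) ℓ) ∧ Even S.card ∧ 5 ∈ S ∧
        (∀ (ℓ : ℕ) [Fact ℓ.Prime], ℓ ∉ S → ((⟨0, 1, 1, -6435, -644416⟩ : WeierstrassCurve ℤ).baseChange ℚ).HasSplitMultiplicativeReductionAtPrime ℓ →
          ¬ 5 ∣ padicValInt ℓ ((⟨0, 1, 1, -6435, -644416⟩ : WeierstrassCurve ℤ).baseChange ℚ).minimalDiscriminantInt) ∧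
        (¬ 5 ∣ padicValInt 5 ((⟨0, 1, 1, -6435, -644416⟩ : WeierstrassCurve ℤ).baseChange ℚ).minimalDiscriminantInt ∨
          ∃ R ⊆ S, S.card = 2 * R.card ∧ ∀ q ∈ R, q ≠ 2 ∧ ¬ 5 ∣ q - 1)) :=
  ⟨RegMult.Rung8085y1.mult_five, not_ram_five, five_dvd_tamagawaProduct, exists_otherMult,
    fun ⟨S, hSm, hSe, h5, hFC, _⟩ ↦ no_inertSet ⟨S, hSm, hSe, h5, hFC⟩⟩

end Summit.BirchSwinnertonDyer.BirchSwinnertonDyer.Theorems.EulerHalfSplitTwinRoad.Rung8085y1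

end
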